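import Literature.MathematicalPhysics.QuantumFieldTheory.Balaban1983to89.B9Cor36GpCubeExtAtV
import Literature.MathematicalPhysics.QuantumFieldTheory.Balaban1983to89.B9CubeLettersInvWriteDict
import Literature.MathematicalPhysics.QuantumFieldTheory.Balaban1983to89.B9Cor36CinvCubeLocLetterMajorant

/-!
# `Balaban1983to89.B9Cor36SiteSandwichTransfer` — [Balaban1985BackgroundPropagators] COROLLARY 3.6 p. 408 / THEOREM 3.7 p. 409 BOOKKEEPING, SITE SECTOR:
# a [4]-(2.51) block majorant of a SITE-SECTOR operator over the CUBE SEQUENCE's blocks, sandwiched between a bi-contractive gauge rotation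
# `R(u)⁻¹ … R(u)` and two scalar cut-offs `M_{g₁} … M_{g₂}` (the right one supported near □), IS a block majorant over the MEMBER's blocks with the
# same rate — the transfer `hE` of the member-side (3.42) block needs, once for each of its terms (sub-row G-B9-LETTERS, module M5.1b-G′, FILE 7b-B of
# seat p33's plan); plus the two elementary «row-local factor» rules of the majorant calculus

statement-level skeleton of published theorems with citation tags; proofs where landed; nothing here is a claim about the Yang–Mills mass gap

CITATION HEADER (lean-in-tree rule).  B9 = T. Bałaban, *Propagators for lattice gauge theories in a background field*, Commun. Math. Phys. **99** (1985)
389–434 [Balaban1985BackgroundPropagators] (held `paper:balaban1985-cmp99-background-propagators`; journal page = PDF page + 388): Cor. 3.6 p. 408 l. 1–14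
(«the operators G_□(U), G′_□(U) … satisfy (3.42)–(3.47) for x, y, y′ ∈ □̃»; «all the results of these theorems are gauge invariant, so they hold for the
configuration U also»); (3.89) p. 409 («for x ∈ Δ(y), supp λ ⊂ Δ(y′), y, y′ ∈ □» — read in the MEMBER's blocks); (3.28)–(3.33) pp. 395–396 (`R(u)` and the
covariance of the letters); (3.42) p. 397.  [4] = [Balaban1984PropagatorsII] (2.51)–(2.55) p. 232 («|(Tλ)(x)| ≦ K(y,y′)|λ|», «this property is preserved
under the composition of operators possessing it»), (2.45)–(2.46) p. 231 (the blocks and their distance).  Rows B9.Cor3.6 × B9.Eq3.89 (cells only; no row head changes).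

WHY THIS FILE (cell lit-balaban, sub-row G-B9-LETTERS, module M5.1b-G′ booked to seat p33; FILE 7b of `lit-balaban-p33/RECORD-M51bGp-g96.md`, steps (iii)–(v)).
p21's M5.5 FILE 6 displays `hE : EBlock (kernelFamilySInv i B cfg O_□ par) B₀ δ₀ U₁` — the (3.42) block of the cube letter `O_□ = M_χ·R(u)⁻¹·G′_□(Ṽ_□)·R(u)·M_χ`
(FILE 2 `locLetterY`) over def-Y's MEMBER geometry `toB6 (geo9K i)` (block map `(z, j) ↦ ιB(Δ(z))`), to be WRITTEN (p21 `B9CubeLettersInvWriteDict`) from four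
conj-`b` majorants over that geometry.  Sect. B delivers the majorants of `conj b(η²G′_□(Ṽ_□))` and its derivative composites over the CUBE SEQUENCE's
geometry `toB6 (geoCK i □)` (block map `(z, j) ↦ Δ_□(z)`, FILE 7b-A).  After the Leibniz/plateau identities (FILE 7b-D) every term of the four member-side
operators is a SANDWICH `M_{g₁}·R(u)⁻¹·M·R(u)·M_{g₂}` of a cube-side `M` with scalar multipliers (`χ`, its shifts and lattice derivatives) — the right one
supported near □.  THIS FILE is the one transfer lemma in between (the site-sector twin of p21's `B9Cor36CinvCubeLocLetterMajorant.hasMajorant_conj_bridge_sandwich`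
for the bond sector; here the two block structures live on the SAME sites, so no bridge `J`/`J⋆` is needed, only r05's coarsening `B9CubeCoarsening`):
* §1 ★`hasMajorant_mul_of_rowLocal`, ★`hasMajorant_mul_of_rowLocal_right` (a factor reading only the row's own block scales a majorant by its row/source
  coefficient — no block sum, no (2.61)), ★`rowLocal_conj_of_local` (an `𝔸`-letter reading its own block, after coordinates);
* §2 the member geometry read at sites: `geo9K_len_site`, `geo9K_dist_site`, and the coarsening comparisons `len_cube_le_len_member` (levels only grow),
  `dist_member_le_dist_cube` (r05's `geomT_dist_coarsen_le`), `blkCubeY_eq_of_blkOf_eq_of_nearH` (near □ a member block is a cube block; p21's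
  `norm_le_sum_mul_of_repr_le` by name);
* §3 ★★★`hasMajorant_conj_site_sandwich` — GENERIC: `conj b M ≺ K_C` over `toB6 (geoCK i □)`, `|g₁| ≤ G₁(Δ_□(·))`, `|g₂| ≤ G₂(Δ_□(·))` with `supp g₂` near □,
  `u` bi-contractive, a member kernel `K ≥ 0` with `G₁(Δ_□x)·K_C(Δ_□x, Δ_□x₀)·G₂(Δ_□x₀) ≤ K(ιBΔ(x), ιBΔ(x₀))` at active sources `x₀` ⟹
  `conj b(M_{g₁}R(u)⁻¹MR(u)M_{g₂}) ≺ (M₂Σ_j‖b_j‖)²·K` over `toB6 (geo9K i)`;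
* §4 ★★`hasMajorant_conj_site_sandwich_decay` — the shape of record: `K_C = B·ℓ_□(a)ⁿ·e^{−δd_□}`, `G₁ = c₁·ℓ_□⁻ᵐ` (`m ≤ n`), `G₂ = c₂` ⟹
  `≺ (M₂Σ‖b‖)²c₁c₂B·ℓ(a)^{n−m}·e^{−δd}` in the member's lengths and distance (levels only grow, distances only shrink under coarsening); ★★`…_decay_src` — the
  source-weighted variant `G₂ = c₂·ℓ_□⁻¹`, `n = 2`, through one scale transfer of the cube geometry (the right cut-off derivative of (3.42)₃).

PROOF.  Ours ([4]'s (2.51) bookkeeping; p21's sandwich pattern; r05's coarsening facts by name).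

HONEST SCOPE / NOT CLAIMED.  Finite bookkeeping; NO estimate of [B9] is proved (the cube-side majorant `hM` is a HYPOTHESIS — FILE 7b-A/7b-C supply it).  The two
factors `M₂Σ‖b‖` are the passage `𝔸 ⇄` real coordinates at the two rotations (print: «gauge invariant», exact; here «with different constants», p. 403).
Inhabited: `g₂ := 0` gives the zero operator and `0 ≺ K`; at `g₁ = g₂ = 1`-near-□, `u = 1` it is r05's `majorant_transfer_of_nearH` read through coordinates —
not a vacuous schema.  Nothing on `d = 4`, the continuum, reflection positivity or the mass gap; NOT a node discharge; no row head changes.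

RELATED IN THE TREE, NOT DUPLICATED: p21 `B9Cor36CinvCubeLocLetterMajorant.hasMajorant_conj_bridge_sandwich` (bond sector, with the bridge `J`), r05
`B9CubeCoarsening.majorant_transfer_of_nearH` (scalar operators, no rotation/cut-offs/coordinates), T9 `B9Eq352DivFormLetters.hasMajorant_conj_of_local` (one
geometry) — USED BY NAME where stated.
-/

noncomputable section

namespace Literature.MathematicalPhysics.QuantumFieldTheory.Balaban1983to89.B9Cor36SiteSandwichTransfer

open Literature.MathematicalPhysics.QuantumFieldTheory.Balaban1983to89
open Literature.MathematicalPhysics.QuantumFieldTheory.Balaban1983to89.B6RandomWalk (HasMajorant BlockSupp hasMajorant_mono)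
open Literature.MathematicalPhysics.QuantumFieldTheory.Balaban1983to89.B9Thm34Ext (toB6)
open Literature.MathematicalPhysics.QuantumFieldTheory.Balaban1983to89.B9Ineq347 (ScaleTransfer)
open Literature.MathematicalPhysics.QuantumFieldTheory.Balaban1983to89.B9Eq39Adjoint (R R_zero R_smul)
open Literature.MathematicalPhysics.QuantumFieldTheory.Balaban1983to89.B9Eq352DivFormLetters (conj conj_apply coordEquiv coordEquiv_apply coordEquiv_symm_apply
  norm_coordSymm_apply_le)
open Literature.MathematicalPhysics.QuantumFieldTheory.Balaban1983to89.B6KLevelCensusIndexV1 (KIdx kGeo)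
open Literature.MathematicalPhysics.QuantumFieldTheory.Balaban1983to89.B6Cover236MultiLevelBlocks (cubes)
open Literature.MathematicalPhysics.QuantumFieldTheory.Balaban1983to89.B6Geom246MultiLevelBox (bset blkOf blkOf_val)
open Literature.MathematicalPhysics.QuantumFieldTheory.Balaban1983to89.B6Geom246MultiLevelTorus (geomT bondT)
open Literature.MathematicalPhysics.QuantumFieldTheory.Balaban1983to89.B6Ineq2142KLevelV1 (β beta_level)
open Literature.MathematicalPhysics.QuantumFieldTheory.Balaban1983to89.B9GeoNormsKLevelV1 (geo9K geo9K_len_kGeo)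
open Literature.MathematicalPhysics.QuantumFieldTheory.Balaban1983to89.B9CubeSequence408 (NearH lev_cubeFam_le)
open Literature.MathematicalPhysics.QuantumFieldTheory.Balaban1983to89.B9CubeCoarsening (coarsen_blkOf geomT_dist_coarsen_le cube_blkOf_eq_of_blkOf_eq_of_nearH)
open Literature.MathematicalPhysics.QuantumFieldTheory.Balaban1983to89.B9CubeLettersOpsL0 (cubeFamY levCubeY two_le_R)
open Literature.MathematicalPhysics.QuantumFieldTheory.Balaban1983to89.B9CubeLettersBondOpsL0 (BlkCubeY)
open Literature.MathematicalPhysics.QuantumFieldTheory.Balaban1983to89.B9Eq360DeltaPrimeACubeY (blkCubeY blkCubeY_apply levCubeY_eq)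
open Literature.MathematicalPhysics.QuantumFieldTheory.Balaban1983to89.B9CubeGeometryInputs (geoCK geoCK_len geoCK_eta geoCK_eta_pos geoCK_dist geoCK_len_pos
  geoCK_len_blkCubeY geoCK_dist_axioms)
open Literature.MathematicalPhysics.QuantumFieldTheory.Balaban1983to89.B9Thm37CubeCoverCommutators (cutMulY cutMulY_apply)
open Literature.MathematicalPhysics.QuantumFieldTheory.Balaban1983to89.B9Cor36CinvCubeLocLetterMajorant (norm_le_sum_mul_of_repr_le)
open Literature.MathematicalPhysics.QuantumFieldTheory.Balaban1983to89.Node00 (SiteY BlkY IBondY CfgY conjY conjY_apply toKT levY)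

variable {d ℓ : ℕ} {hd : 1 ≤ d + 1} {hL : Odd (ℓ + 1) ∧ 1 < ℓ + 1} {b₀ b₁ : ℝ}
variable {𝔸 : Type} [NormedRing 𝔸] [NormedAlgebra ℂ 𝔸] [CompleteSpace 𝔸]
variable {ι : Type} [Fintype ι]

/-! ## §1  Row-local factors in [4]'s majorant calculus -/

section RowLocal

variable {g : B6.Geometry} {X : Type}

/-- ★ **A ROW-LOCAL LEFT FACTOR SCALES A MAJORANT BY ITS ROW COEFFICIENT** (no block sum, no (2.61)): if `|(T₁w)(x)| ≤ c(Δ(x))·sup_{Δ(x)}|w|` for every `w`, and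
`T₂ ≺ K₂`, then `T₁T₂ ≺ c(a)·K₂(a, a′)`. [cite: Balaban1984PropagatorsII, (2.52) p.232 («a block-diagonal factor»), (2.51) p.232] -/
theorem hasMajorant_mul_of_rowLocal (blk : X → g.Site) {T₁ T₂ : Module.End ℝ (X → ℝ)} (c : g.Site → ℝ)
    (h₁ : ∀ (w : X → ℝ) (x : X) (M : ℝ), (∀ x', blk x' = blk x → |w x'| ≤ M) → |T₁ w x| ≤ c (blk x) * M)
    {K₂ : g.Site → g.Site → ℝ} (h₂ : HasMajorant (g := g) blk T₂ K₂) :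
    HasMajorant (g := g) blk (T₁ * T₂) (fun a a' => c a * K₂ a a') := by
  intro y' μ B hμ x
  rw [Module.End.mul_apply]
  have h := h₁ (T₂ μ) x (K₂ (blk x) y' * B) (fun x' hx' => by rw [← hx']; exact h₂ y' μ B hμ x')
  exact h.trans (le_of_eq (by ring))

/-- ★ **A ROW-LOCAL RIGHT FACTOR SCALES A MAJORANT BY ITS SOURCE COEFFICIENT**: a row-local `T₁` with `c ≥ 0` maps a source supported in `Δ(y′)` with
`|source| ≤ B` to one supported in `Δ(y′)` with `|·| ≤ c(y′)B`; so `T₂T₁ ≺ K₂(a, a′)·c(a′)`. [cite: Balaban1984PropagatorsII, (2.52) p.232, (2.51) p.232] -/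
theorem hasMajorant_mul_of_rowLocal_right (blk : X → g.Site) {T₁ T₂ : Module.End ℝ (X → ℝ)} (c : g.Site → ℝ) (hc : ∀ a, 0 ≤ c a)
    (h₁ : ∀ (w : X → ℝ) (x : X) (M : ℝ), (∀ x', blk x' = blk x → |w x'| ≤ M) → |T₁ w x| ≤ c (blk x) * M)
    {K₂ : g.Site → g.Site → ℝ} (h₂ : HasMajorant (g := g) blk T₂ K₂) :
    HasMajorant (g := g) blk (T₂ * T₁) (fun a a' => K₂ a a' * c a') := by
  intro y' μ B hμ x
  rw [Module.End.mul_apply]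
  have hsupp : BlockSupp (g := g) blk (T₁ μ) y' (c y' * B) := by
    refine ⟨mul_nonneg (hc y') hμ.nonneg, fun x' hx' => ?_, fun x' hx' => ?_⟩
    · have h := h₁ μ x' B (fun x'' hx'' => hμ.bound x'' (hx''.trans hx'))
      rwa [hx'] at h
    · have h := h₁ μ x' 0 (fun x'' hx'' => by rw [hμ.off x'' (fun h => hx' (hx''.symm.trans h)), abs_zero])
      rw [mul_zero] at h
      exact abs_eq_zero.1 (le_antisymm h (abs_nonneg _))
  exact (h₂ y' _ _ hsupp x).trans (le_of_eq (by ring))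

variable (b : Module.Basis ι ℝ 𝔸)

omit [CompleteSpace 𝔸] in
/-- ★ **AN `𝔸`-LETTER READING ITS OWN BLOCK IS ROW-LOCAL AFTER COORDINATES**, coefficient `c(a)·M₂(Σ_j‖b_j‖)`: from `‖(Tf)(x)‖ ≤ c(Δ(x))·sup_{Δ(x)}‖f‖` to
`|(conj b T w)(x, j)| ≤ c(Δ(x))·M₂Σ‖b‖·sup_{Δ(x)×ι}|w|`. [cite: Balaban1984PropagatorsII, (2.51)–(2.52) p.232; Balaban1985BackgroundPropagators, (3.39) p.397] -/
theorem rowLocal_conj_of_local {S Y : Type} (blk : S → Y) (c : Y → ℝ) {M₂ : ℝ} (hM₂ : 0 ≤ M₂)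
    (hrepr : ∀ (v : 𝔸) (j : ι), |b.repr v j| ≤ M₂ * ‖v‖) (T : Module.End ℝ (S → 𝔸))
    (hT : ∀ (f : S → 𝔸) (x : S) (Bf : ℝ), (∀ x', blk x' = blk x → ‖f x'‖ ≤ Bf) → ‖T f x‖ ≤ c (blk x) * Bf) :
    ∀ (w : S × ι → ℝ) (p : S × ι) (M : ℝ), (∀ p' : S × ι, blk p'.1 = blk p.1 → |w p'| ≤ M) →
      |conj b T w p| ≤ c (blk p.1) * (M₂ * ∑ j, ‖b j‖) * M := by
  intro w p M hw
  have hf : ∀ x', blk x' = blk p.1 → ‖(coordEquiv b).symm w x'‖ ≤ (∑ j, ‖b j‖) * M := fun x' hx' =>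
    norm_coordSymm_apply_le b w x' M fun j => hw (x', j) hx'
  have h1 : ‖T ((coordEquiv b).symm w) p.1‖ ≤ c (blk p.1) * ((∑ j, ‖b j‖) * M) := hT _ p.1 _ hf
  rw [conj_apply]
  calc |b.repr (T ((coordEquiv b).symm w) p.1) p.2| ≤ M₂ * ‖T ((coordEquiv b).symm w) p.1‖ := hrepr _ _
    _ ≤ M₂ * (c (blk p.1) * ((∑ j, ‖b j‖) * M)) := mul_le_mul_of_nonneg_left h1 hM₂
    _ = c (blk p.1) * (M₂ * ∑ j, ‖b j‖) * M := by ring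

end RowLocal

/-! ## §2  The member geometry read at sites; coarsening comparisons with the cube sequence's geometry -/

section MemberGeometry

variable (i : KIdx d ℓ hd hL b₀ b₁) (c : ↥(cubes (toKT i).D.toDomains)) (ιB : BlkY i → IBondY i) (hι : ∀ s, β i.hN i.D i.hk (ιB s) = s)

include hι in
/-- the member's (3.41) length at the carrier index of the block of `z`: `L^{lev z}·η`. [cite: Balaban1985BackgroundPropagators, (3.41) p.397; Balaban1984PropagatorsII, (2.1) p.224] -/
theorem geo9K_len_site (z : SiteY i) : (geo9K i).len (ιB (blkOf i.D.toDomains z)) = ((ℓ : ℝ) + 1) ^ levY i z * (kGeo i).eta := by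
  have hk1 : 1 ≤ i.k := le_trans (by norm_num) i.hk2
  rw [geo9K_len_kGeo, B6KLevelCensusIndexV1.len_eq, ← beta_level i.hN i.D i.hk hk1, hι, blkOf_val, div_eq_mul_inv]
  push_cast
  rfl

include hι in
/-- the member's (2.46) distance at carrier indices of blocks of sites is `d_T` of the blocks. [cite: Balaban1984PropagatorsII, (2.46) p.231, dictionary] -/
theorem geo9K_dist_site (z w : SiteY i) :
    (geo9K i).dist (ιB (blkOf i.D.toDomains z)) (ιB (blkOf i.D.toDomains w)) = (geomT i.D).dist (blkOf i.D.toDomains z) (blkOf i.D.toDomains w) := by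
  show (geomT i.D).dist (β i.hN i.D i.hk _) (β i.hN i.D i.hk _) = _
  rw [hι, hι]

include hι in
/-- **LEVELS ONLY GROW UNDER COARSENING**: `ℓ_□(Δ_□(z)) ≤ ℓ(Δ(z))`. [cite: Balaban1985BackgroundPropagators, p.408 (Ω_n(□) ⊂ Ω_n); Balaban1984PropagatorsII, (2.1) p.224] -/
theorem len_cube_le_len_member (z : SiteY i) : (geoCK i c).len (blkCubeY i c z) ≤ (geo9K i).len (ιB (blkOf i.D.toDomains z)) := by
  rw [(geoCK_len_blkCubeY i c z).1, geo9K_len_site i ιB hι]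
  have hη : 0 < (kGeo i).eta := by rw [← geoCK_eta i c]; exact geoCK_eta_pos i c
  have hL1 : (1 : ℝ) ≤ (ℓ : ℝ) + 1 := by linarith [(Nat.cast_nonneg ℓ : (0 : ℝ) ≤ ℓ)]
  exact mul_le_mul_of_nonneg_right (pow_le_pow_right₀ hL1 (lev_cubeFam_le z.1)) hη.le

include hι in
/-- **DISTANCES ONLY SHRINK UNDER COARSENING**: `d(Δ(z), Δ(w)) ≤ d_□(Δ_□(z), Δ_□(w))` (r05's `geomT_dist_coarsen_le`). [cite: Balaban1984PropagatorsII, (2.46) p.231; Balaban1985BackgroundPropagators, (3.89) p.409] -/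
theorem dist_member_le_dist_cube (z w : SiteY i) :
    (geo9K i).dist (ιB (blkOf i.D.toDomains z)) (ιB (blkOf i.D.toDomains w)) ≤ (geoCK i c).dist (blkCubeY i c z) (blkCubeY i c w) := by
  rw [geo9K_dist_site i ιB hι]
  have h := geomT_dist_coarsen_le (D := (toKT i).D) (q := c) (hL := hL.1) (hM := B9CubeLettersOpsL0.oddMh i) (toKT i).hMh (toKT i).hP
    (blkCubeY i c z) (blkCubeY i c w)
  rw [blkCubeY_apply, blkCubeY_apply] at h
  unfold cubeFamY at h
  rw [coarsen_blkOf, coarsen_blkOf] at h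
  exact h

/-- **NEAR □ A MEMBER BLOCK IS A CUBE BLOCK**: sites of the member block of a site near □ have its cube block. [cite: Balaban1985BackgroundPropagators, p.408, (3.89) p.409; Balaban1984PropagatorsII, (2.45) p.231] -/
theorem blkCubeY_eq_of_blkOf_eq_of_nearH {w₀ w : SiteY i} (hw₀ : NearH c w₀.1) (h : blkOf i.D.toDomains w = blkOf i.D.toDomains w₀) :
    blkCubeY i c w = blkCubeY i c w₀ :=
  cube_blkOf_eq_of_blkOf_eq_of_nearH (D := (toKT i).D) (two_le_R i) hw₀ h

end MemberGeometry

/-! ## §3  ★★★ The sandwich transfer: cube-sequence blocks → member blocks -/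

section Transfer

variable (i : KIdx d ℓ hd hL b₀ b₁) (c : ↥(cubes (toKT i).D.toDomains)) (b : Module.Basis ι ℝ 𝔸)

omit [CompleteSpace 𝔸] in
/-- ★★★ **THE SITE-SECTOR SANDWICH TRANSFER.**  Let `M` be an `ℝ`-linear operator on the `𝔸`-valued site functions whose coordinate conjugate has the block
majorant `K_C` over the cube sequence's geometry `toB6 (geoCK i □)`; let `u` be a bi-contractive site gauge, `g₁, g₂` real multipliers with `|g₁(z)| ≤ G₁(Δ_□(z))`,
`|g₂(z)| ≤ G₂(Δ_□(z))` and `g₂` supported near □ (`NearH`); let `K ≥ 0` be a kernel on the member's carrier indices dominating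
`G₁(Δ_□x)·K_C(Δ_□x, Δ_□x₀)·G₂(Δ_□x₀)` for every row site `x` and every active source site `x₀` (`g₂(x₀) ≠ 0`).  Then over the member's geometry
`toB6 (geo9K i)` (block map `(z, j) ↦ ιB(Δ(z))`): `conj b (M_{g₁}·R(u)⁻¹·M·R(u)·M_{g₂}) ≺ (M₂Σ_j‖b_j‖)²·K`.  (A source in the member block `Δ(y′)` is cut to
`supp g₂` — empty, or `Δ(y′)` has a site near □ and IS a cube block — rotated at no cost, its coordinates bounded by `M₂Σ‖b‖·G₂·|source|`; `M` maps it under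
`K_C(·, Δ_□(x₀))`; the row factor costs `G₁(Δ_□x)·M₂Σ‖b‖`.) [cite: Balaban1985BackgroundPropagators, Cor. 3.6 p.408 l.1–14, (3.89) p.409, (3.28)–(3.33) pp.395–396; Balaban1984PropagatorsII, (2.51)–(2.55) p.232, (2.45)–(2.46) p.231] -/
theorem hasMajorant_conj_site_sandwich {M₂ : ℝ} (hM₂ : 0 ≤ M₂) (hrepr : ∀ (v : 𝔸) (j : ι), |b.repr v j| ≤ M₂ * ‖v‖)
    (γ : SiteY i → 𝔸ˣ) (hγ : ∀ z a, ‖R (γ z) a‖ ≤ ‖a‖ ∧ ‖R (γ z)⁻¹ a‖ ≤ ‖a‖)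
    (g₁ g₂ : SiteY i → ℝ) (G₁ G₂ : BlkCubeY i c → ℝ) (hG₁ : ∀ z, |g₁ z| ≤ G₁ (blkCubeY i c z)) (hG₂ : ∀ z, |g₂ z| ≤ G₂ (blkCubeY i c z))
    (hnear : ∀ z, g₂ z ≠ 0 → NearH c z.1)
    (ιB : BlkY i → IBondY i) (hι : ∀ s, β i.hN i.D i.hk (ιB s) = s) (Rr : ℝ) (H : Prop) [Fintype (geo9K i).Site] (Rr' : ℝ) (Hp : Prop)
    {KC : BlkCubeY i c → BlkCubeY i c → ℝ} {K : IBondY i → IBondY i → ℝ} (hK : ∀ a a', 0 ≤ K a a')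
    (hcmp : ∀ x x₀ : SiteY i, g₂ x₀ ≠ 0 →
      G₁ (blkCubeY i c x) * KC (blkCubeY i c x) (blkCubeY i c x₀) * G₂ (blkCubeY i c x₀) ≤ K (ιB (blkOf i.D.toDomains x)) (ιB (blkOf i.D.toDomains x₀)))
    (M : Module.End ℝ (SiteY i → 𝔸)) (hM : HasMajorant (g := toB6 (geoCK i c) Rr H) (fun p : SiteY i × ι => blkCubeY i c p.1) (conj b M) KC) :
    HasMajorant (g := toB6 (geo9K i) Rr' Hp) (fun p : SiteY i × ι => ιB (blkOf i.D.toDomains p.1))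
      (conj b ((cutMulY (𝔸 := 𝔸) g₁).restrictScalars ℝ ∘ₗ (conjY γ⁻¹).restrictScalars ℝ ∘ₗ M ∘ₗ (conjY γ).restrictScalars ℝ ∘ₗ
        (cutMulY (𝔸 := 𝔸) g₂).restrictScalars ℝ))
      (fun a a' => (M₂ * ∑ j, ‖b j‖) ^ 2 * K a a') := by
  intro y' μ B hμ x
  have hSb : 0 ≤ ∑ j, ‖b j‖ := Finset.sum_nonneg fun _ _ => norm_nonneg _
  have hKB : 0 ≤ (M₂ * ∑ j, ‖b j‖) ^ 2 * K (ιB (blkOf i.D.toDomains x.1)) y' * B := mul_nonneg (mul_nonneg (sq_nonneg _) (hK _ _)) hμ.nonneg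
  -- the source as an `𝔸`-valued function, cut and rotated
  set lam : SiteY i → 𝔸 := (coordEquiv b).symm μ with hlam
  set ν : SiteY i → 𝔸 := conjY γ (cutMulY g₂ lam) with hν
  rw [conj_apply]
  simp only [LinearMap.comp_apply, LinearMap.restrictScalars_apply]
  rw [← hlam]
  change |b.repr (cutMulY g₁ (conjY γ⁻¹ (M ν)) x.1) x.2| ≤ (M₂ * ∑ j, ‖b j‖) ^ 2 * K (ιB (blkOf i.D.toDomains x.1)) y' * B
  rw [cutMulY_apply, conjY_apply, Pi.inv_apply]
  -- the row factor: `|repr (g₁(x)·R(γ(x))⁻¹ a)| ≤ M₂·|g₁ x|·‖a‖`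
  have hrowfac : |b.repr ((((g₁ x.1 : ℝ) : ℂ)) • R (γ x.1)⁻¹ (M ν x.1)) x.2| ≤ M₂ * (G₁ (blkCubeY i c x.1) * ‖M ν x.1‖) := by
    refine (hrepr _ _).trans (mul_le_mul_of_nonneg_left ?_ hM₂)
    rw [norm_smul, Complex.norm_real, Real.norm_eq_abs]
    exact mul_le_mul (hG₁ x.1) ((hγ x.1 _).2) (norm_nonneg _) ((abs_nonneg _).trans (hG₁ x.1))
  -- the source: every value of `lam` is bounded by `(Σ‖b‖)·B`, and `lam` vanishes off the member block over `y′`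
  have hlam_bd : ∀ w, ‖lam w‖ ≤ (∑ j, ‖b j‖) * B := fun w => by
    by_cases hw : ιB (blkOf i.D.toDomains w) = y'
    · rw [hlam]; exact norm_coordSymm_apply_le b μ w B fun j => hμ.bound (w, j) hw
    · have h0 : lam w = 0 := by
        rw [hlam, coordEquiv_symm_apply]
        exact Finset.sum_eq_zero fun j _ => by rw [hμ.off (w, j) hw, zero_smul]
      rw [h0, norm_zero]; exact mul_nonneg hSb hμ.nonneg
  have hlam_off : ∀ w, ιB (blkOf i.D.toDomains w) ≠ y' → lam w = 0 := fun w hw => by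
    rw [hlam, coordEquiv_symm_apply]
    exact Finset.sum_eq_zero fun j _ => by rw [hμ.off (w, j) hw, zero_smul]
  have hν_val : ∀ w, ν w = R (γ w) ((((g₂ w : ℝ) : ℂ)) • lam w) := fun w => by rw [hν, conjY_apply, cutMulY_apply]
  -- either `ν = 0`, or there is an active source site `w₀` (then near □, in the member block over `y′`)
  by_cases hex : ∃ w₀, g₂ w₀ ≠ 0 ∧ lam w₀ ≠ 0
  swap
  · have hν0 : ν = 0 := funext fun w => by
      rw [hν_val]
      by_cases h2 : g₂ w = 0
      · rw [h2, Complex.ofReal_zero, zero_smul, R_zero]; rfl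
      · have hl : lam w = 0 := by
          by_contra hl; exact hex ⟨w, h2, hl⟩
        rw [hl, smul_zero, R_zero]; rfl
    rw [hν0, map_zero, Pi.zero_apply, R_zero, smul_zero, map_zero, Finsupp.zero_apply, abs_zero]
    exact hKB
  obtain ⟨w₀, hg₂w₀, hlamw₀⟩ := hex
  have hy' : ιB (blkOf i.D.toDomains w₀) = y' := by
    by_contra h; exact hlamw₀ (hlam_off w₀ h)
  have hw₀near : NearH c w₀.1 := hnear w₀ hg₂w₀
  set s₀ : BlkCubeY i c := blkCubeY i c w₀ with hs₀
  have hG₂0 : 0 ≤ G₂ s₀ := (abs_nonneg _).trans (hG₂ w₀)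
  -- sites carrying the source lie in the cube block `s₀`
  have hblk : ∀ w, lam w ≠ 0 → blkCubeY i c w = s₀ := fun w hw => by
    have h1 : ιB (blkOf i.D.toDomains w) = y' := by
      by_contra h; exact hw (hlam_off w h)
    have h2 : blkOf i.D.toDomains w = blkOf i.D.toDomains w₀ := by
      have h3 := congrArg (β i.hN i.D i.hk) (h1.trans hy'.symm)
      rwa [hι, hι] at h3
    exact blkCubeY_eq_of_blkOf_eq_of_nearH i c hw₀near h2
  -- the coordinates of `ν`: a source over the cube geometry supported in `s₀`
  have hνsupp : BlockSupp (g := toB6 (geoCK i c) Rr H) (fun p : SiteY i × ι => blkCubeY i c p.1) (coordEquiv b ν) s₀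
      (M₂ * (G₂ s₀ * ((∑ j, ‖b j‖) * B))) := by
    refine ⟨mul_nonneg hM₂ (mul_nonneg hG₂0 (mul_nonneg hSb hμ.nonneg)), fun p hp => ?_, fun p hp => ?_⟩
    · rw [coordEquiv_apply]
      refine (hrepr _ _).trans (mul_le_mul_of_nonneg_left ?_ hM₂)
      rw [hν_val]
      refine ((hγ p.1 _).1).trans ?_
      rw [norm_smul, Complex.norm_real, Real.norm_eq_abs]
      have hp' : blkCubeY i c p.1 = s₀ := hp
      exact mul_le_mul ((hG₂ p.1).trans (by rw [hp'])) (hlam_bd p.1) (norm_nonneg _) hG₂0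
    · rw [coordEquiv_apply]
      have hl : lam p.1 = 0 := by
        by_contra hl; exact hp (hblk p.1 hl)
      rw [hν_val, hl, smul_zero, R_zero, map_zero, Finsupp.zero_apply]
  -- the cube-side majorant on that source, read at the rows `(x.1, j′)`
  have hrow : ∀ j', |b.repr (M ν x.1) j'| ≤ KC (blkCubeY i c x.1) s₀ * (M₂ * (G₂ s₀ * ((∑ j, ‖b j‖) * B))) := fun j' => by
    have h := hM s₀ (coordEquiv b ν) _ hνsupp (x.1, j')
    rwa [conj_apply, LinearEquiv.symm_apply_apply] at h
  have hnorm : ‖M ν x.1‖ ≤ (∑ j, ‖b j‖) * (KC (blkCubeY i c x.1) s₀ * (M₂ * (G₂ s₀ * ((∑ j, ‖b j‖) * B)))) :=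
    norm_le_sum_mul_of_repr_le b _ hrow
  have hc := hcmp x.1 w₀ hg₂w₀
  rw [hy'] at hc
  have hG₁0 : 0 ≤ G₁ (blkCubeY i c x.1) := (abs_nonneg _).trans (hG₁ x.1)
  calc |b.repr ((((g₁ x.1 : ℝ) : ℂ)) • R (γ x.1)⁻¹ (M ν x.1)) x.2| ≤ M₂ * (G₁ (blkCubeY i c x.1) * ‖M ν x.1‖) := hrowfac
    _ ≤ M₂ * (G₁ (blkCubeY i c x.1) * ((∑ j, ‖b j‖) * (KC (blkCubeY i c x.1) s₀ * (M₂ * (G₂ s₀ * ((∑ j, ‖b j‖) * B)))))) :=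
        mul_le_mul_of_nonneg_left (mul_le_mul_of_nonneg_left hnorm hG₁0) hM₂
    _ = (M₂ * ∑ j, ‖b j‖) ^ 2 * (G₁ (blkCubeY i c x.1) * KC (blkCubeY i c x.1) (blkCubeY i c w₀) * G₂ (blkCubeY i c w₀)) * B := by
        rw [hs₀]; ring
    _ ≤ (M₂ * ∑ j, ‖b j‖) ^ 2 * K (ιB (blkOf i.D.toDomains x.1)) y' * B :=
        mul_le_mul_of_nonneg_right (mul_le_mul_of_nonneg_left hc (sq_nonneg _)) hμ.nonneg

end Transfer

/-! ## §4  The shapes of record: decaying cube-side kernels with length weights -/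

section Decay

variable (i : KIdx d ℓ hd hL b₀ b₁) (c : ↥(cubes (toKT i).D.toDomains)) (b : Module.Basis ι ℝ 𝔸)

omit [CompleteSpace 𝔸] in
/-- ★★ **THE SANDWICH TRANSFER FOR `K_C = B·ℓ_□(a)ⁿ·e^{−δd_□(a,a′)}`, ROW MULTIPLIER `|g₁| ≤ c₁·ℓ_□⁻ᵐ` (`m ≤ n`), CUT-OFF `|g₂| ≤ c₂` NEAR □**:
`conj b (M_{g₁}R(u)⁻¹MR(u)M_{g₂}) ≺ (M₂Σ‖b‖)²c₁c₂B·ℓ(a)^{n−m}·e^{−δd(a,a′)}` over the member's geometry — levels only grow and distances only shrink under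
coarsening, so the cube-currency bound dominates the member-currency one (r05's p. 409 reading).
[cite: Balaban1985BackgroundPropagators, Cor. 3.6 p.408, (3.89) p.409, Thm 3.1 (3.42) p.397; Balaban1984PropagatorsII, (2.51) p.232, (2.46) p.231] -/
theorem hasMajorant_conj_site_sandwich_decay {M₂ : ℝ} (hM₂ : 0 ≤ M₂) (hrepr : ∀ (v : 𝔸) (j : ι), |b.repr v j| ≤ M₂ * ‖v‖)
    (γ : SiteY i → 𝔸ˣ) (hγ : ∀ z a, ‖R (γ z) a‖ ≤ ‖a‖ ∧ ‖R (γ z)⁻¹ a‖ ≤ ‖a‖)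
    (g₁ g₂ : SiteY i → ℝ) {c₁ c₂ : ℝ} (hc₁ : 0 ≤ c₁) (hc₂ : 0 ≤ c₂) {m n : ℕ} (hmn : m ≤ n)
    (hg₁ : ∀ z, |g₁ z| * (geoCK i c).len (blkCubeY i c z) ^ m ≤ c₁) (hg₂ : ∀ z, |g₂ z| ≤ c₂) (hnear : ∀ z, g₂ z ≠ 0 → NearH c z.1)
    (ιB : BlkY i → IBondY i) (hι : ∀ s, β i.hN i.D i.hk (ιB s) = s) (Rr : ℝ) (H : Prop) [Fintype (geo9K i).Site] (Rr' : ℝ) (Hp : Prop)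
    {B δ : ℝ} (hB : 0 ≤ B) (hδ : 0 ≤ δ) (M : Module.End ℝ (SiteY i → 𝔸))
    (hM : HasMajorant (g := toB6 (geoCK i c) Rr H) (fun p : SiteY i × ι => blkCubeY i c p.1) (conj b M)
      (fun a a' => B * (geoCK i c).len a ^ n * Real.exp (-(δ * (geoCK i c).dist a a')))) :
    HasMajorant (g := toB6 (geo9K i) Rr' Hp) (fun p : SiteY i × ι => ιB (blkOf i.D.toDomains p.1))
      (conj b ((cutMulY (𝔸 := 𝔸) g₁).restrictScalars ℝ ∘ₗ (conjY γ⁻¹).restrictScalars ℝ ∘ₗ M ∘ₗ (conjY γ).restrictScalars ℝ ∘ₗ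
        (cutMulY (𝔸 := 𝔸) g₂).restrictScalars ℝ))
      (fun a a' => (M₂ * ∑ j, ‖b j‖) ^ 2 * (c₁ * c₂ * B) * (geo9K i).len a ^ (n - m) * Real.exp (-(δ * (geo9K i).dist a a'))) := by
  have hlenpos : ∀ z, 0 < (geoCK i c).len (blkCubeY i c z) := fun z => geoCK_len_pos i c _
  refine hasMajorant_mono (g := toB6 (geo9K i) Rr' Hp) _
    (hasMajorant_conj_site_sandwich i c b hM₂ hrepr γ hγ g₁ g₂ (fun s => c₁ * ((geoCK i c).len s ^ m)⁻¹) (fun _ => c₂)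
      (fun z => ?_) hg₂ hnear ιB hι Rr H Rr' Hp (K := fun a a' => (c₁ * c₂ * B) * (geo9K i).len a ^ (n - m) * Real.exp (-(δ * (geo9K i).dist a a')))
      (fun a a' => ?_) (fun x x₀ _ => ?_) M hM)
    fun a a' => le_of_eq (by ring)
  · -- `|g₁ z| ≤ c₁·ℓ_□(Δ_□z)⁻ᵐ`
    have hp := pow_pos (hlenpos z) m
    rw [← div_eq_mul_inv, le_div_iff₀ hp]
    exact hg₁ z
  · exact mul_nonneg (mul_nonneg (mul_nonneg (mul_nonneg hc₁ hc₂) hB) (pow_nonneg (B6KLevelCensusIndexV1.len_pos i a).le _)) (Real.exp_nonneg _)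
  · -- the comparison at the row `x` and the active source `x₀`
    have hlx := hlenpos x
    have hLC := len_cube_le_len_member i c ιB hι x
    have hdD := dist_member_le_dist_cube i c ιB hι x x₀
    have hpow : (geoCK i c).len (blkCubeY i c x) ^ n * ((geoCK i c).len (blkCubeY i c x) ^ m)⁻¹ = (geoCK i c).len (blkCubeY i c x) ^ (n - m) := by
      rw [pow_sub₀ _ hlx.ne' hmn]
    have hexp : Real.exp (-(δ * (geoCK i c).dist (blkCubeY i c x) (blkCubeY i c x₀))) ≤
        Real.exp (-(δ * (geo9K i).dist (ιB (blkOf i.D.toDomains x)) (ιB (blkOf i.D.toDomains x₀)))) :=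
      Real.exp_le_exp.2 (by nlinarith)
    have hpw : (geoCK i c).len (blkCubeY i c x) ^ (n - m) ≤ (geo9K i).len (ιB (blkOf i.D.toDomains x)) ^ (n - m) :=
      pow_le_pow_left₀ hlx.le hLC _
    calc c₁ * ((geoCK i c).len (blkCubeY i c x) ^ m)⁻¹ * (B * (geoCK i c).len (blkCubeY i c x) ^ n *
          Real.exp (-(δ * (geoCK i c).dist (blkCubeY i c x) (blkCubeY i c x₀)))) * c₂
        = (c₁ * c₂ * B) * ((geoCK i c).len (blkCubeY i c x) ^ n * ((geoCK i c).len (blkCubeY i c x) ^ m)⁻¹) *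
          Real.exp (-(δ * (geoCK i c).dist (blkCubeY i c x) (blkCubeY i c x₀))) := by ring
      _ = (c₁ * c₂ * B) * (geoCK i c).len (blkCubeY i c x) ^ (n - m) * Real.exp (-(δ * (geoCK i c).dist (blkCubeY i c x) (blkCubeY i c x₀))) := by
          rw [hpow]
      _ ≤ (c₁ * c₂ * B) * (geo9K i).len (ιB (blkOf i.D.toDomains x)) ^ (n - m) *
          Real.exp (-(δ * (geo9K i).dist (ιB (blkOf i.D.toDomains x)) (ιB (blkOf i.D.toDomains x₀)))) :=
          mul_le_mul (mul_le_mul_of_nonneg_left hpw (mul_nonneg (mul_nonneg hc₁ hc₂) hB)) hexp (Real.exp_nonneg _)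
            (mul_nonneg (mul_nonneg (mul_nonneg hc₁ hc₂) hB) (pow_nonneg (B6KLevelCensusIndexV1.len_pos i _).le _))

omit [CompleteSpace 𝔸] in
/-- ★★ **THE SOURCE-WEIGHTED VARIANT** (the right cut-off derivative of (3.42)₃): `K_C = B·ℓ_□(a)²·e^{−δd_□}`, `|g₁| ≤ c₁`, `|g₂| ≤ c₂·ℓ_□⁻¹` near □, and ONE
scale transfer of the cube geometry `e^{−αδd_□(a,a′)}ℓ_□(a′)⁻¹ ≤ Λ·ℓ_□(a)⁻¹` (p. 398 remark; FILE 5a `hST_geoCK`, third component) ⟹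
`≺ (M₂Σ‖b‖)²c₁c₂BΛ·ℓ(a)·e^{−(1−α)δd(a,a′)}` over the member's geometry.
[cite: Balaban1985BackgroundPropagators, Cor. 3.6 p.408, Thm 3.1 (3.42)₃ p.397, p.398 (remark after (3.47)); Balaban1984PropagatorsII, (2.51) p.232, (2.46) p.231] -/
theorem hasMajorant_conj_site_sandwich_decay_src {M₂ : ℝ} (hM₂ : 0 ≤ M₂) (hrepr : ∀ (v : 𝔸) (j : ι), |b.repr v j| ≤ M₂ * ‖v‖)
    (γ : SiteY i → 𝔸ˣ) (hγ : ∀ z a, ‖R (γ z) a‖ ≤ ‖a‖ ∧ ‖R (γ z)⁻¹ a‖ ≤ ‖a‖)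
    (g₁ g₂ : SiteY i → ℝ) {c₁ c₂ : ℝ} (hc₁ : 0 ≤ c₁) (hc₂ : 0 ≤ c₂)
    (hg₁ : ∀ z, |g₁ z| ≤ c₁) (hg₂ : ∀ z, |g₂ z| * (geoCK i c).len (blkCubeY i c z) ≤ c₂) (hnear : ∀ z, g₂ z ≠ 0 → NearH c z.1)
    (ιB : BlkY i → IBondY i) (hι : ∀ s, β i.hN i.D i.hk (ιB s) = s) (Rr : ℝ) (H : Prop) [Fintype (geo9K i).Site] (Rr' : ℝ) (Hp : Prop)
    {B δ α Λ : ℝ} (hB : 0 ≤ B) (hδ : 0 ≤ δ) (hα1 : α ≤ 1) (hΛ : 0 ≤ Λ)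
    (hST : ScaleTransfer (geoCK i c) δ α Λ (fun a => ((geoCK i c).len a)⁻¹))
    (M : Module.End ℝ (SiteY i → 𝔸))
    (hM : HasMajorant (g := toB6 (geoCK i c) Rr H) (fun p : SiteY i × ι => blkCubeY i c p.1) (conj b M)
      (fun a a' => B * (geoCK i c).len a ^ 2 * Real.exp (-(δ * (geoCK i c).dist a a')))) :
    HasMajorant (g := toB6 (geo9K i) Rr' Hp) (fun p : SiteY i × ι => ιB (blkOf i.D.toDomains p.1))
      (conj b ((cutMulY (𝔸 := 𝔸) g₁).restrictScalars ℝ ∘ₗ (conjY γ⁻¹).restrictScalars ℝ ∘ₗ M ∘ₗ (conjY γ).restrictScalars ℝ ∘ₗ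
        (cutMulY (𝔸 := 𝔸) g₂).restrictScalars ℝ))
      (fun a a' => (M₂ * ∑ j, ‖b j‖) ^ 2 * (c₁ * c₂ * B * Λ) * (geo9K i).len a * Real.exp (-((1 - α) * δ * (geo9K i).dist a a'))) := by
  have hlenpos : ∀ z, 0 < (geoCK i c).len (blkCubeY i c z) := fun z => geoCK_len_pos i c _
  have hdnn := (geoCK_dist_axioms i c Rr H).1
  refine hasMajorant_mono (g := toB6 (geo9K i) Rr' Hp) _
    (hasMajorant_conj_site_sandwich i c b hM₂ hrepr γ hγ g₁ g₂ (fun _ => c₁) (fun s => c₂ * ((geoCK i c).len s)⁻¹)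
      hg₁ (fun z => ?_) hnear ιB hι Rr H Rr' Hp
      (K := fun a a' => (c₁ * c₂ * B * Λ) * (geo9K i).len a * Real.exp (-((1 - α) * δ * (geo9K i).dist a a')))
      (fun a a' => ?_) (fun x x₀ _ => ?_) M hM)
    fun a a' => le_of_eq (by ring)
  · rw [← div_eq_mul_inv, le_div_iff₀ (hlenpos z)]
    exact hg₂ z
  · exact mul_nonneg (mul_nonneg (mul_nonneg (mul_nonneg (mul_nonneg hc₁ hc₂) hB) hΛ) (B6KLevelCensusIndexV1.len_pos i a).le) (Real.exp_nonneg _)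
  · have hlx := hlenpos x
    have hLC := len_cube_le_len_member i c ιB hι x
    have hdD := dist_member_le_dist_cube i c ιB hι x x₀
    set dC := (geoCK i c).dist (blkCubeY i c x) (blkCubeY i c x₀) with hdC
    -- the scale transfer moves the source weight `ℓ_□(x₀)⁻¹` to the row at the cost `Λ·e^{αδd_□}`
    have hT := hST (blkCubeY i c x) (blkCubeY i c x₀)
    have hsplit : Real.exp (-(δ * dC)) = Real.exp (-(α * δ * dC)) * Real.exp (-((1 - α) * δ * dC)) := by
      rw [← Real.exp_add]; ring_nf
    have hexp : Real.exp (-((1 - α) * δ * dC)) ≤ Real.exp (-((1 - α) * δ * (geo9K i).dist (ιB (blkOf i.D.toDomains x)) (ιB (blkOf i.D.toDomains x₀)))) := by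
      refine Real.exp_le_exp.2 ?_
      have h1 : 0 ≤ (1 - α) * δ := mul_nonneg (by linarith) hδ
      nlinarith
    have key : ((geoCK i c).len (blkCubeY i c x)) ^ 2 * Real.exp (-(δ * dC)) * ((geoCK i c).len (blkCubeY i c x₀))⁻¹ ≤
        Λ * (geoCK i c).len (blkCubeY i c x) * Real.exp (-((1 - α) * δ * dC)) := by
      rw [hsplit]
      have h2 : Real.exp (-(α * δ * dC)) * ((geoCK i c).len (blkCubeY i c x₀))⁻¹ ≤ Λ * ((geoCK i c).len (blkCubeY i c x))⁻¹ := hT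
      have hl2 : 0 ≤ (geoCK i c).len (blkCubeY i c x) ^ 2 * Real.exp (-((1 - α) * δ * dC)) := mul_nonneg (sq_nonneg _) (Real.exp_nonneg _)
      calc (geoCK i c).len (blkCubeY i c x) ^ 2 * (Real.exp (-(α * δ * dC)) * Real.exp (-((1 - α) * δ * dC))) * ((geoCK i c).len (blkCubeY i c x₀))⁻¹
          = ((geoCK i c).len (blkCubeY i c x) ^ 2 * Real.exp (-((1 - α) * δ * dC))) * (Real.exp (-(α * δ * dC)) * ((geoCK i c).len (blkCubeY i c x₀))⁻¹) := by
            ring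
        _ ≤ ((geoCK i c).len (blkCubeY i c x) ^ 2 * Real.exp (-((1 - α) * δ * dC))) * (Λ * ((geoCK i c).len (blkCubeY i c x))⁻¹) :=
            mul_le_mul_of_nonneg_left h2 hl2
        _ = Λ * (geoCK i c).len (blkCubeY i c x) * Real.exp (-((1 - α) * δ * dC)) := by
            field_simp
    have hpre : 0 ≤ c₁ * c₂ * B := mul_nonneg (mul_nonneg hc₁ hc₂) hB
    calc c₁ * (B * (geoCK i c).len (blkCubeY i c x) ^ 2 * Real.exp (-(δ * dC))) * (c₂ * ((geoCK i c).len (blkCubeY i c x₀))⁻¹)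
        = (c₁ * c₂ * B) * ((geoCK i c).len (blkCubeY i c x) ^ 2 * Real.exp (-(δ * dC)) * ((geoCK i c).len (blkCubeY i c x₀))⁻¹) := by ring
      _ ≤ (c₁ * c₂ * B) * (Λ * (geoCK i c).len (blkCubeY i c x) * Real.exp (-((1 - α) * δ * dC))) := mul_le_mul_of_nonneg_left key hpre
      _ = (c₁ * c₂ * B * Λ) * (geoCK i c).len (blkCubeY i c x) * Real.exp (-((1 - α) * δ * dC)) := by ring
      _ ≤ (c₁ * c₂ * B * Λ) * (geo9K i).len (ιB (blkOf i.D.toDomains x)) *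
          Real.exp (-((1 - α) * δ * (geo9K i).dist (ιB (blkOf i.D.toDomains x)) (ιB (blkOf i.D.toDomains x₀)))) :=
          mul_le_mul (mul_le_mul_of_nonneg_left hLC (mul_nonneg hpre hΛ)) hexp (Real.exp_nonneg _)
            (mul_nonneg (mul_nonneg hpre hΛ) (B6KLevelCensusIndexV1.len_pos i _).le)

end Decay

end Literature.MathematicalPhysics.QuantumFieldTheory.Balaban1983to89.B9Cor36SiteSandwichTransfer

end
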